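import Literature.MathematicalPhysics.QuantumFieldTheory.Balaban1983to89.Beta.RemainderDelta2TorusForm

/-!
# T. Bałaban, *Propagators for lattice gauge theories in a background field*, Commun. Math. Phys. **99** (1985) 389–434 [Balaban1985BackgroundPropagators]
# (3.137) p. 423 *«hence |(Δ⁽²⁾A)(b)| ≦ O(1)Mα₀(Lʲη)⁻²|A|, b ∈ Δ(y), y ∈ Λ_j, (3.137) and the supremum |A| is taken over several j-blocks surrounding Δ(y)»*,
# from [Balaban1985Averaging] (149) p. 40 *«|⟨(δ∕δA)C_j(U₀,A), δA⟩| ≦ C₃|A|Q″_j|δA|»*: **(3.137) FOR BAŁABAN's `Δ⁽²⁾` ON THE TORUS `T_{Lᵏm}` WITH AN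
# ARBITRARY COEFFICIENT FIELD — PRINT's LOCAL-SUP DISPLAY, IN THE SHAPE OF ROW (D4)'s SOCKET «Y13a»** («Y17b», row (D4) OWNER lineage, gen 114)

CITATION HEADER (lean-in-tree rule 2026-08-18).  Audit cell `pub-balaban`, BINDER row (D4) (`RemainderConst` leaves for Bałaban's split), OWNER lineage
`b2b-balaban-beta-an4`, gen 114.  Loci as in «Y17a» `Beta.RemainderDelta2TorusForm`: [Balaban1985BackgroundPropagators] (B9 = [5]; held
`paper:balaban1985-cmp99-background-propagators`, journal page = PDF page + 388) (3.134)–(3.137) pp. 422–423 (re-read first-hand this generation), (3.11)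
p. 392, (3.15) p. 393; [Balaban1985Averaging] (B7 = [4]; `paper:balaban1985-cmp98-averaging`) (136)–(138), (141) p. 39, (149) p. 40, (52) p. 26, (145) p. 39,
(155) p. 41, p. 24, p. 34.  Composed BY NAME: r06's `B9Ineq3137LocalSup.ineq149_secondOrder_local` ∕ `boxProj` ∕ `norm_boxProj_le`, p06's
`B7Eq136SecondOrder.hasFDerivAt_CCovIter2_ins`, `B7Prop5GeneralOperators.kerQdd_of_bondIn`, `B7Prop2Explicit.avgClosed_unitaryUnits`, «Y17a» §3, an2's
`B11Eq98V0primeCurrentSlots.rieszτ` ∕ `rieszτ_apply` ∕ `trace_rieszτ_mul`.  Nothing of print is asserted here.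

WHY THIS FILE («Y17b»).  **`exists_delta2_torus_of_coeff`**: under [4] Prop. 5's regime at a unitary-valued flat background `U₀` ((52) at the `k`-th scale,
the (145)∕(155) smallnesses at a witness radius `b`), on the torus `P = fineP (Lᵏ) m` (stated for any `P` with `hP : P = fineP (Lᵏ) m`, so that the consumer
instantiates `P := towerP L m (n+1)`, `hP := towerP_eq_fineP_pow`), for the fibre `φ` (`‖φ‖ ≤ M_φ`, `‖φ⁻¹‖ ≤ M_φ′`), the trace `τ` (`|τ(XY)| ≤ M_τ‖X‖‖Y‖`,
`τ(XY) = τ(YX)`, `⟪φ⁻¹X, φ⁻¹Y⟫ = τ(X*Y)`), the scale `η`, the weight `c₀ ≠ 0` and a coefficient field with `‖K‖_∞ ≤ K_max`: THERE IS a `ℂ`-linear `Δ⁽²⁾` on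
the fine bond fields with (a) the polarised (3.136) identity of «Y17a» §1 and (b) **(3.137) in the shape of «Y13a»'s hypothesis `hD2`**: for every `A`, fine
bond `b`, `F ≥ 0` with `‖A(b′)‖ ≤ F` on the fine bonds `b′` whose block lies within `d₁`-distance `d` of the block of `b`,
`‖(Δ⁽²⁾A)(b)‖ ≤ λ₀·F`, `λ₀ = ‖c₀‖⁻¹·M_φ′M_φ²·(2d)·M_τ·C₃·(Lᵏ)²·(‖η‖M_φ)·((Lᵏ)^{−d}·2^d·‖η‖)·K_max` — at the tower's normalisation `‖η‖Lᵏ = 1`, `‖c₀‖ = η^d`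
this is `2^{d+1}d·M_τM_φ³M_φ′·C₃·K_max = O(1)·K_max`, and `K_max = O(α)` for `K = φ(H̃_k†(φ⁻¹J))` by «Y14».  Mechanism: the value `(Δ⁽²⁾A)(b) =
c₀⁻¹φ⁻¹(ρ(ℓ_b))`, `‖ρ(ℓ)‖ ≤ M_φ²‖ℓ‖`; the functional `ℓ_b(X) = Σ_c τ(B_c(χ_cA, χ_c(δ_bφ⁻¹X))K(c))` has at most `2d` nonzero terms (the coarse bonds whose box
holds a flat copy of `b`, «Y17a» `blockCoord_of_mem_boxBonds` ∕ `sum_indicator_two_blocks_le`), each bounded by (149) with the LOCAL supremum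
(`ineq149_secondOrder_local` at the chart point; `‖χ_cA‖ ≤ ‖η‖M_φF` because every flat bond of the box reads in `c₋` or `c₊`, both within `d₁ ≤ d` of the
block of `b`; the column `Σ_s L^{−kd}‖χ_c(δ_bX)_s‖ ≤ L^{−kd}·2^d·‖η‖‖X‖` by the copies count `card_filter_bondsIn_perSite_le`).

HONEST SCOPE.  [folklore] bookkeeping around ONE printed estimate used BY NAME ((149) for `C_k⁽²⁾` with the local supremum, r06 ∕ p06); the regime, `U₀`,
`K` are HYPOTHESES; `K = H̃\*J` and the tower's normalisations are the consumer's («Y17c», the successor's junction with «Y14» and «Y13a∕b∕c»); an OBJECT on the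
cell's MODEL carriers (one level `j = k`), NOT Bałaban's multiscale `Δ⁽²⁾` on `𝔅`, NOT `Δ⁽²⁾_π`, NOT (3.138); constants crude.  Row (D4) class UNCHANGED
(instance 0∕1; critical-path width 0 = NODE O; D4 DISCHARGE NO DATE); NOT B12 Thm 2, NOT BetaPertH, NOT continuum, NOT Clay.  HONEST DEPENDENCY (cell line):
continuum YM on T⁴ ⇐ BetaPertH ∧ nine spine estimates (0/9 proved); BetaPertH ⇐ (D1) ∧ (D4) ∧ CAP+tail; G-an2-4 gates asym, D1 and NE2/3/4.  NEW file;
nothing modified; 0 `def`; standard axioms; no `sorry`.  Net new unproved facts: 0.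
-/

noncomputable section

open scoped BigOperators InnerProductSpace ComplexConjugate

namespace Literature.MathematicalPhysics.QuantumFieldTheory.Balaban1983to89.Beta.RemainderDelta2TorusLocalSup

open B7Prop1Local (AgreeOn InBox loK bondHiK)
open B7Prop3Flat (insCfg)
open B7Prop5Flat (restr)
open B7Prop5GeneralInduction (CCovIter)
open B7Eq136SecondOrder (CCovIter2)
open B12Ineq417Flat (boxBonds)
open B9SectCLatticeCarrier (Bond bpos)
open B4Sect5Torus (TSite)
open B9Eq315QTorus (perCfg perCfg_apply perSite)
open B9Eq311L2Pairing (WL2)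
open B11Eq98V0primeCurrentSlots (rieszτ trace_rieszτ_mul)

open Beta.RemainderDelta2TorusForm (sum_indicator_two_blocks_le card_filter_bondsIn_perSite_le blockCoord_of_mem_boxBonds bondHiK_lt_loK_add
  tdist1_two_blocks_le)

/-! ## §4  THE ASSEMBLY: `Δ⁽²⁾` of a coefficient field on the torus `T_{L^k m}` — (3.136) polarised AND print's (3.137) local-sup display -/

section Assembly

open B7Prop2Explicit (AvgClosed pdev C0 c2')
open B7Prop3Flat (c3)
open B7Prop5Flat (BondIn bondsIn mem_bondsIn)
open B7Prop5GeneralLevels (thetaGen C3Gen)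
open B7Prop5GeneralOperators (kerQdd kerQdd_of_bondIn)
open B9Ineq3137LocalSup (boxProj norm_boxProj_le ineq149_secondOrder_local)
open B9SectCLatticeCarrier (shift unshift)
open B9Eq319QprimeTorus (fineP blockCoord)
open B9Eq316TowerFlatIsOneStep (siteCast siteCast_rfl)
open B5TorusCover (UT)
open B9Thm37GlueTorus (tdist1)

variable {d : ℕ} {𝔸 : Type*} [CStarAlgebra 𝔸] [Nontrivial 𝔸]
  {W : Type*} [NormedAddCommGroup W] [InnerProductSpace ℂ W] [FiniteDimensional ℂ W]

variable (L : ℕ) (hL : 2 ≤ L) (k : ℕ)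
  (U₀ : B7Prop1Explicit.Site d → Fin d → 𝔸ˣ) (hU₀ : ∀ x κ, U₀ x κ ∈ B7Prop2Explicit.unitaryUnits 𝔸) {α₀ : ℝ} (hα : 0 < α₀)
  (hα3 : C0 d * α₀ ≤ 1 / 3) (hα4 : 4 * α₀ ≤ c2' d L) (h52 : pdev U₀ < α₀ * (((L : ℝ) ^ k)⁻¹) ^ 2)
  {b : ℝ} (hb : 0 < b)
  (hsmall : Real.exp (4 * (800 * ((d : ℝ) + 1) ^ 2 * ((d : ℝ) + 4)) * α₀)
    * (1 + 8 * (131072 * ((d : ℝ) + 1) ^ 2) * ((L : ℝ) ^ k * b)) ≤ 2)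
  (hc₃ : 4 * ((L : ℝ) ^ k * b) < c3 d L)
  (h145 : 8 * d * thetaGen d L α₀ * (L : ℝ)⁻¹ ^ 4 ≤ 1)
  (h155 : (2 * (L : ℝ) - 1) * (L : ℝ)⁻¹ ^ 2 + 2 * d * thetaGen d L α₀ * (L : ℝ)⁻¹ ^ 3
    + 1 / 8 * (1 + 2 * d * thetaGen d L α₀ * (L : ℝ)⁻¹ ^ 2 + 2 * d * C3Gen d L * ((L : ℝ) ^ k * b)) * (L : ℝ)⁻¹ ^ 2 ≤ 1)
  (m : Fin d → ℕ) [∀ i, NeZero (m i)] (hm : ∀ i, 1 ≤ m i) (P : Fin d → ℕ) [∀ i, NeZero (P i)] (hP : P = fineP (L ^ k) m)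
  (φ : W ≃ₗ[ℂ] 𝔸) {Mφ Mφ' : ℝ} (hMφ : 0 ≤ Mφ) (hMφ' : 0 ≤ Mφ') (hφ : ∀ w, ‖φ w‖ ≤ Mφ * ‖w‖) (hφ' : ∀ X, ‖φ.symm X‖ ≤ Mφ' * ‖X‖)
  (τ : 𝔸 →ₗ[ℂ] ℂ) {Mτ : ℝ} (hτm : ∀ X Y : 𝔸, ‖τ (X * Y)‖ ≤ Mτ * ‖X‖ * ‖Y‖) (hMτ : 0 ≤ Mτ)
  (hτ₂ : ∀ X Y : 𝔸, τ (X * Y) = τ (Y * X)) (hφτ : ∀ X Y : 𝔸, ⟪φ.symm X, φ.symm Y⟫_ℂ = τ (star X * Y))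
  (η c₀ : ℂ) (hc₀ : c₀ ≠ 0) (K : Bond d m → 𝔸) {Kmax : ℝ} (hKmax : 0 ≤ Kmax) (hK : ∀ c, ‖K c‖ ≤ Kmax)

include hL hU₀ hα hα3 hα4 h52 hb hsmall hc₃ h145 h155 hm hMφ hMφ' hφ hφ' hτm hMτ hτ₂ hφτ hc₀ hKmax hK in
/-- **BAŁABAN's `Δ⁽²⁾` ON THE TORUS `T_{L^k m}` FOR A COEFFICIENT FIELD `K` ON THE COARSE BONDS: (3.136) POLARISED AND PRINT's (3.137) LOCAL-SUP DISPLAY.**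
Under [4] Prop. 5's regime at the flat background `U₀` (unitary-valued; (52) at the `k`-th scale; the (145)∕(155) smallnesses at a witness radius `b`), for the
torus `P = fineP (L^k) m` (blocks = the unit torus `T_m`, `m ≥ 1`), the fibre `φ`, the trace `τ` (`|τ(XY)| ≤ M_τ‖X‖‖Y‖`, `τ(XY) = τ(YX)`, `⟪φ⁻¹X, φ⁻¹Y⟫ =
τ(X*Y)`), the bond-variable scale `η`, the pairing weight `c₀ ≠ 0` and `‖K‖_∞ ≤ K_max`: THERE IS a `ℂ`-linear `Δ⁽²⁾` on the fine bond fields with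
(a) `Σ_b c₀τ(φ(δA(b))φ((Δ⁽²⁾A)(b))) = Σ_c τ(B_c(χ_cA, χ_cδA)·K(c))` for all `A, δA` (§1; with §2, `δA = A` gives (3.134) *«⟨A,Δ⁽²⁾A⟩ = 2⟨HC⁽²⁾(A),J⟩»*), and
(b) **(3.137)**: for every `A`, fine bond `b` and `F ≥ 0` bounding `‖A(b′)‖` on the fine bonds `b′` whose block lies within `d₁`-distance `d` of the block of `b`,
`‖(Δ⁽²⁾A)(b)‖ ≤ λ₀·F`, `λ₀ = ‖c₀‖⁻¹·M_φ′M_φ²·(2d)·M_τ·C₃(Lᵏ)²·(‖η‖M_φ)·((Lᵏ)^{−d}·2^d·‖η‖)·K_max` — *«|(Δ⁽²⁾A)(b)| ≤ O(1)Mα₀(Lʲη)⁻²|A|, the supremum over several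
j-blocks surrounding Δ(y)»*: at `‖η‖Lᵏ = 1`, `‖c₀‖ = η^d` this is `O(1)·C₃·K_max`, and `K_max = O(α)` by the `(H̃\*J)`-budget.  Mechanism: (149) for `C_k⁽²⁾`
with the LOCAL supremum (r06's `ineq149_secondOrder_local`) on the chart of the box of each of the `≤ 2d` coarse bonds seeing `b`, `≤ 2^d` flat copies of `b`
per box, the dualising map's bound `‖ρ(ℓ)‖ ≤ M_φ²‖ℓ‖`. [cite: Balaban1985BackgroundPropagators, (3.134)–(3.137) pp.422–423, (3.11) p.392]
[cite: Balaban1985Averaging, (136)–(138) p.39, (141) p.39, (149) p.40, (52) p.26, (145) p.39, (155) p.41, p.24 (after (43)), p.34] -/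
theorem exists_delta2_torus_of_coeff :
    ∃ D2 : (Bond d P → W) →ₗ[ℂ] (Bond d P → W),
      (∀ A δA : Bond d P → W,
        ∑ b : Bond d P, c₀ * τ (φ (δA b) * φ (D2 A b)) =
          ∑ c : Bond d m, τ
            (fderiv ℂ (fderiv ℂ (fun a' : ↥(boxBonds L k (fun i => ((c.1 i : ℕ) : ℤ)) c.2) → 𝔸 =>
                CCovIter L U₀ (insCfg (boxBonds L k (fun i => ((c.1 i : ℕ) : ℤ)) c.2) a') k (fun i => ((c.1 i : ℕ) : ℤ)) c.2)) 0
              (restr (boxBonds L k (fun i => ((c.1 i : ℕ) : ℤ)) c.2) (perCfg P fun b => η • φ (A b)))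
              (restr (boxBonds L k (fun i => ((c.1 i : ℕ) : ℤ)) c.2) (perCfg P fun b => η • φ (δA b))) * K c)) ∧
      (∀ (A : Bond d P → W) (b : Bond d P) (F : ℝ), 0 ≤ F →
        (∀ b' : Bond d P, tdist1 m (UT.ofSite m (blockCoord (L ^ k) m (siteCast hP (bpos b))))
            (UT.ofSite m (blockCoord (L ^ k) m (siteCast hP (bpos b')))) ≤ d → ‖A b'‖ ≤ F) →
        ‖D2 A b‖ ≤ (‖c₀‖⁻¹ * Mφ' * Mφ ^ 2 * ((2 * d) * (Mτ * (C3Gen d L * ((L : ℝ) ^ k) ^ 2 * (‖η‖ * Mφ) *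
            ((((L : ℝ) ^ k) ^ d)⁻¹ * 2 ^ d * ‖η‖)) * Kmax))) * F) := by
  classical
  subst hP
  haveI : FiniteDimensional ℂ 𝔸 := LinearEquiv.finiteDimensional φ
  have hL1 : 1 ≤ L := le_trans (by norm_num) hL
  set z : Bond d m → B7Prop1Explicit.Site d := fun c i => ((c.1 i : ℕ) : ℤ) with hz
  let χ : (c : Bond d m) → (Bond d (fineP (L ^ k) m) → W) →ₗ[ℂ] (↥(boxBonds L k (z c) c.2) → 𝔸) := fun c =>
    { toFun := fun A => restr (boxBonds L k (z c) c.2) (perCfg (fineP (L ^ k) m) fun b => η • φ (A b))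
      map_add' := fun A A' => by
        funext s; simp [restr, perCfg_apply, smul_add]
      map_smul' := fun t A => by
        funext s; simp [restr, perCfg_apply, smul_comm η t] }
  let Bc : (c : Bond d m) → (↥(boxBonds L k (z c) c.2) → 𝔸) →L[ℂ] (↥(boxBonds L k (z c) c.2) → 𝔸) →L[ℂ] 𝔸 := fun c =>
    fderiv ℂ (fderiv ℂ (fun a' : ↥(boxBonds L k (z c) c.2) → 𝔸 => CCovIter L U₀ (insCfg (boxBonds L k (z c) c.2) a') k (z c) c.2)) 0
  let τK : Bond d m → 𝔸 →L[ℂ] ℂ := fun c => LinearMap.toContinuousLinearMap (τ ∘ₗ LinearMap.mulRight ℂ (K c))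
  let ℓ : Bond d (fineP (L ^ k) m) → (Bond d (fineP (L ^ k) m) → W) →ₗ[ℂ] (𝔸 →L[ℂ] ℂ) := fun b =>
    ∑ c : Bond d m,
      { toFun := fun A => (τK c).comp (((Bc c) (χ c A)).comp
          (LinearMap.toContinuousLinearMap ((χ c) ∘ₗ LinearMap.single ℂ (fun _ : Bond d (fineP (L ^ k) m) => W) b ∘ₗ φ.symm.toLinearMap)))
        map_add' := fun A A' => by
          ext X; simp only [map_add, add_apply, ContinuousLinearMap.coe_comp, Function.comp_apply,
            ContinuousLinearMap.add_comp, ContinuousLinearMap.comp_add]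
        map_smul' := fun t A => by
          ext X; simp only [map_smul, smul_apply, ContinuousLinearMap.coe_comp, Function.comp_apply,
            ContinuousLinearMap.smul_comp, ContinuousLinearMap.comp_smul, RingHom.id_apply] }
  let D2b : Bond d (fineP (L ^ k) m) → (Bond d (fineP (L ^ k) m) → W) →ₗ[ℂ] W := fun b =>
    (c₀⁻¹ • φ.symm.toLinearMap) ∘ₗ (rieszτ φ).toLinearMap ∘ₗ ℓ b
  -- `ℓ_b(A)(X)` unfolded (used by both conjuncts)
  have hℓX : ∀ (A : Bond d (fineP (L ^ k) m) → W) (b : Bond d (fineP (L ^ k) m)) (X : 𝔸), ℓ b A X =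
      ∑ c : Bond d m, τ ((Bc c) (χ c A) (χ c (Pi.single b (φ.symm X))) * K c) := by
    intro A b X
    simp only [ℓ, LinearMap.coe_sum, Finset.sum_apply, LinearMap.coe_mk, AddHom.coe_mk, FunLike.coe_sum,
      ContinuousLinearMap.coe_comp, Function.comp_apply, LinearMap.coe_toContinuousLinearMap', LinearMap.coe_comp,
      LinearEquiv.coe_coe, LinearMap.coe_single, τK, LinearMap.mulRight_apply]
  have hval : ∀ (A : Bond d (fineP (L ^ k) m) → W) (b : Bond d (fineP (L ^ k) m)),
      LinearMap.pi D2b A b = c₀⁻¹ • φ.symm (rieszτ φ (ℓ b A)) := by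
    intro A b; simp [D2b, LinearMap.pi_apply]
  refine ⟨LinearMap.pi D2b, fun A δA => ?_, fun A b F hF hA => ?_⟩
  · -- (a) the polarised (3.136): as in §1
    have hb : ∀ b : Bond d (fineP (L ^ k) m), c₀ * τ (φ (δA b) * φ (LinearMap.pi D2b A b)) = ℓ b A (φ (δA b)) := by
      intro b
      have h1 : φ (LinearMap.pi D2b A b) = c₀⁻¹ • rieszτ φ (ℓ b A) := by rw [hval]; simp [map_smul]
      rw [h1, mul_smul_comm, map_smul, smul_eq_mul, ← mul_assoc, mul_inv_cancel₀ hc₀, one_mul, hτ₂,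
        ← ContinuousLinearMap.coe_coe]
      have := trace_rieszτ_mul φ (LinearMap.toContinuousLinearMap τ) (fun X Y => by simpa using hφτ X Y) (ℓ b A) (φ (δA b))
      simpa using this
    simp_rw [hb, hℓX, LinearEquiv.symm_apply_apply]
    rw [Finset.sum_comm]
    refine Finset.sum_congr rfl fun c _ => ?_
    have hsum : ∑ b : Bond d (fineP (L ^ k) m), (Bc c) (χ c A) (χ c (Pi.single b (δA b))) = (Bc c) (χ c A) (χ c δA) := by
      rw [← map_sum, ← map_sum]
      congr 1
      congr 1
      exact (Finset.univ_sum_single δA)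
    calc ∑ b : Bond d (fineP (L ^ k) m), τ ((Bc c) (χ c A) (χ c (Pi.single b (δA b))) * K c)
        = τ ((∑ b : Bond d (fineP (L ^ k) m), (Bc c) (χ c A) (χ c (Pi.single b (δA b)))) * K c) := by rw [Finset.sum_mul, map_sum]
      _ = τ ((Bc c) (χ c A) (χ c δA) * K c) := by rw [hsum]
      _ = _ := rfl
  · -- (b) the (3.137) display
    simp only [siteCast_rfl, Equiv.refl_apply] at hA
    -- the block of `b`
    set yb : TSite d m := blockCoord (L ^ k) m (bpos b) with hyb
    -- constants
    have hLk : (0 : ℝ) < (L : ℝ) ^ k := by positivity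
    set Tc : ℝ := C3Gen d L * ((L : ℝ) ^ k) ^ 2 * (‖η‖ * Mφ * F) * ((((L : ℝ) ^ k) ^ d)⁻¹ * 2 ^ d * ‖η‖) with hTc
    have hC3 : 0 ≤ C3Gen d L := by unfold C3Gen B7Prop5GeneralLevels.C1ppGen; positivity
    have hTc0 : 0 ≤ Tc := by rw [hTc]; positivity
    -- (b1) the dualising map is bounded: `‖ρ(ℓ′)‖ ≤ M_φ²‖ℓ′‖`
    have hriesz : ∀ ℓ' : 𝔸 →L[ℂ] ℂ, ‖rieszτ φ ℓ'‖ ≤ Mφ * Mφ * ‖ℓ'‖ := by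
      intro ℓ'
      rw [B11Eq98V0primeCurrentSlots.rieszτ_apply, norm_star]
      have hφL : ‖(LinearMap.toContinuousLinearMap φ.toLinearMap : W →L[ℂ] 𝔸)‖ ≤ Mφ :=
        ContinuousLinearMap.opNorm_le_bound _ hMφ fun w => by simpa using hφ w
      refine (hφ _).trans ?_
      rw [mul_assoc]
      refine mul_le_mul_of_nonneg_left ?_ hMφ
      rw [LinearIsometryEquiv.norm_map]
      exact (ContinuousLinearMap.opNorm_comp_le _ _).trans (by
        rw [mul_comm]; exact mul_le_mul_of_nonneg_right hφL (norm_nonneg _))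
    -- (b2) per coarse bond: the term vanishes unless the box of `c` holds a flat copy of `b`, and then (149) with the LOCAL supremum
    have hterm : ∀ (c : Bond d m) (X : 𝔸),
        ‖τ ((Bc c) (χ c A) (χ c (Pi.single b (φ.symm X))) * K c)‖ ≤
          if c.1 = yb ∨ shift c.2 c.1 = yb then Mτ * Tc * Kmax * ‖X‖ else 0 := by
      intro c X
      by_cases hcb : c.1 = yb ∨ shift c.2 c.1 = yb
      · rw [if_pos hcb]
        -- the variation on the chart
        have hδ : ∀ s : ↥(boxBonds L k (z c) c.2), ‖χ c (Pi.single b (φ.symm X)) s‖ =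
            if (perSite (fineP (L ^ k) m) s.1.1, s.1.2) = b then ‖η‖ * ‖X‖ else 0 := by
          intro s
          show ‖η • φ ((Pi.single b (φ.symm X) : Bond d (fineP (L ^ k) m) → W) (perSite (fineP (L ^ k) m) s.1.1, s.1.2))‖ = _
          by_cases hs : (perSite (fineP (L ^ k) m) s.1.1, s.1.2) = b
          · rw [if_pos hs, hs, Pi.single_eq_same, LinearEquiv.apply_symm_apply, norm_smul]
          · rw [if_neg hs, Pi.single_eq_of_ne hs, map_zero, smul_zero, norm_zero]
        -- the field on the chart: sup ≤ ‖η‖ M_φ F (every flat bond of the box reads on the two blocks of `c`, both within `d₁ ≤ d` of the block of `b`)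
        have hχA : ‖χ c A‖ ≤ ‖η‖ * Mφ * F := by
          refine (pi_norm_le_iff_of_nonneg (by positivity)).2 fun s => ?_
          show ‖η • φ (A (perSite (fineP (L ^ k) m) s.1.1, s.1.2))‖ ≤ _
          rw [norm_smul, mul_assoc]
          refine mul_le_mul_of_nonneg_left ((hφ _).trans (mul_le_mul_of_nonneg_left (hA _ ?_) hMφ)) (norm_nonneg _)
          have hs := blockCoord_of_mem_boxBonds L k m c.1 c.2 s.2
          exact tdist1_two_blocks_le hm c.1 c.2 (by rcases hcb with h | h <;> [exact Or.inl h.symm; exact Or.inr h.symm]) hs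
        -- (149) with the local supremum
        have h149 := ineq149_secondOrder_local L hL (B7Prop2Explicit.avgClosed_unitaryUnits d L) k U₀ hU₀ hα hα3 hα4 h52 hb hsmall hc₃ h145 h155
          (boxBonds L k (z c) c.2) le_rfl (z c) c.2 (χ c A) (χ c (Pi.single b (φ.symm X)))
        have hfd : fderiv ℂ (fun a' : ↥(boxBonds L k (z c) c.2) → 𝔸 => CCovIter2 L U₀ (insCfg (boxBonds L k (z c) c.2) a') k (z c) c.2)
            (χ c A) = (Bc c) (χ c A) :=
          (B7Eq136SecondOrder.hasFDerivAt_CCovIter2_ins L hL (B7Prop2Explicit.avgClosed_unitaryUnits d L) k U₀ hU₀ hα hα3 hα4 h52 hb hsmall hc₃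
            (boxBonds L k (z c) c.2) le_rfl (z c) c.2 (χ c A)).fderiv
        rw [hfd] at h149
        -- the column sum: `Σ_s kerQdd·‖δ_s‖ ≤ (Lᵏ)^{−d}·2^d·‖η‖‖X‖`
        have hker : ∑ s : ↥(boxBonds L k (z c) c.2), kerQdd L k (z c) c.2 s.1.1 s.1.2 * ‖χ c (Pi.single b (φ.symm X)) s‖ ≤
            (((L : ℝ) ^ k) ^ d)⁻¹ * 2 ^ d * ‖η‖ * ‖X‖ := by
          have hks : ∀ s : ↥(boxBonds L k (z c) c.2), kerQdd L k (z c) c.2 s.1.1 s.1.2 = (((L : ℝ) ^ k) ^ d)⁻¹ :=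
            fun s => kerQdd_of_bondIn (mem_bondsIn.1 s.2)
          have hcard := card_filter_bondsIn_perSite_le (fineP (L ^ k) m) (loK L k (z c)) (bondHiK L k (z c) c.2)
            (bondHiK_lt_loK_add L k hL1 hm c.1 c.2) b
          have hsub : (Finset.univ.filter fun s : ↥(boxBonds L k (z c) c.2) => (perSite (fineP (L ^ k) m) s.1.1, s.1.2) = b).card ≤
              ((bondsIn (loK L k (z c)) (bondHiK L k (z c) c.2)).filter fun s => (perSite (fineP (L ^ k) m) s.1, s.2) = b).card := by
            refine Finset.card_le_card_of_injOn (fun s => (s : B7Prop1Explicit.Site d × Fin d)) (fun s hs => ?_) (fun s _ s' _ h => Subtype.ext h)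
            rw [Finset.coe_filter, Set.mem_setOf_eq] at hs ⊢
            exact ⟨s.2, hs.2⟩
          have hcnt : ((Finset.univ.filter fun s : ↥(boxBonds L k (z c) c.2) =>
              (perSite (fineP (L ^ k) m) s.1.1, s.1.2) = b).card : ℝ) ≤ 2 ^ d := by
            exact_mod_cast hsub.trans hcard
          have hS : ∑ s : ↥(boxBonds L k (z c) c.2), (if (perSite (fineP (L ^ k) m) s.1.1, s.1.2) = b then ‖η‖ * ‖X‖ else 0) ≤
              2 ^ d * (‖η‖ * ‖X‖) := by
            rw [← Finset.sum_filter, Finset.sum_const, nsmul_eq_mul]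
            exact mul_le_mul_of_nonneg_right hcnt (by positivity)
          simp_rw [hks, hδ]
          rw [← Finset.mul_sum]
          calc (((L : ℝ) ^ k) ^ d)⁻¹ * ∑ s : ↥(boxBonds L k (z c) c.2),
                (if (perSite (fineP (L ^ k) m) s.1.1, s.1.2) = b then ‖η‖ * ‖X‖ else 0)
              ≤ (((L : ℝ) ^ k) ^ d)⁻¹ * (2 ^ d * (‖η‖ * ‖X‖)) := mul_le_mul_of_nonneg_left hS (by positivity)
            _ = _ := by ring
        have hs0 : 0 ≤ ∑ s : ↥(boxBonds L k (z c) c.2), kerQdd L k (z c) c.2 s.1.1 s.1.2 * ‖χ c (Pi.single b (φ.symm X)) s‖ :=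
          Finset.sum_nonneg fun s _ => mul_nonneg (by unfold kerQdd; split_ifs <;> positivity) (norm_nonneg _)
        have h1 : ‖boxProj (boxBonds L k (z c) c.2) L k (z c) c.2 (χ c A)‖ ≤ ‖η‖ * Mφ * F :=
          (norm_boxProj_le _ L k (z c) c.2 _).trans hχA
        have hB0 : 0 ≤ Mτ * (C3Gen d L * ((L : ℝ) ^ k) ^ 2 * ‖boxProj (boxBonds L k (z c) c.2) L k (z c) c.2 (χ c A)‖ *
            ∑ s : ↥(boxBonds L k (z c) c.2), kerQdd L k (z c) c.2 s.1.1 s.1.2 * ‖χ c (Pi.single b (φ.symm X)) s‖) :=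
          mul_nonneg hMτ (mul_nonneg (mul_nonneg (mul_nonneg hC3 (by positivity)) (norm_nonneg _)) hs0)
        calc ‖τ ((Bc c) (χ c A) (χ c (Pi.single b (φ.symm X))) * K c)‖
            ≤ Mτ * ‖(Bc c) (χ c A) (χ c (Pi.single b (φ.symm X)))‖ * ‖K c‖ := hτm _ _
          _ ≤ Mτ * (C3Gen d L * ((L : ℝ) ^ k) ^ 2 * ‖boxProj (boxBonds L k (z c) c.2) L k (z c) c.2 (χ c A)‖ *
                ∑ s : ↥(boxBonds L k (z c) c.2), kerQdd L k (z c) c.2 s.1.1 s.1.2 * ‖χ c (Pi.single b (φ.symm X)) s‖) * Kmax :=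
              mul_le_mul (mul_le_mul_of_nonneg_left h149 hMτ) (hK c) (norm_nonneg _) hB0
          _ ≤ Mτ * (C3Gen d L * ((L : ℝ) ^ k) ^ 2 * (‖η‖ * Mφ * F) * ((((L : ℝ) ^ k) ^ d)⁻¹ * 2 ^ d * ‖η‖ * ‖X‖)) * Kmax := by
              refine mul_le_mul_of_nonneg_right (mul_le_mul_of_nonneg_left ?_ hMτ) hKmax
              exact mul_le_mul (mul_le_mul_of_nonneg_left h1 (by positivity)) hker hs0 (by positivity)
          _ = Mτ * Tc * Kmax * ‖X‖ := by rw [hTc]; ring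
      · rw [if_neg hcb]
        -- no flat bond of the box of `c` reads as `b`: the variation vanishes on the chart
        have hzero : χ c (Pi.single b (φ.symm X)) = 0 := by
          funext s
          show η • φ ((Pi.single b (φ.symm X) : Bond d (fineP (L ^ k) m) → W) (perSite (fineP (L ^ k) m) s.1.1, s.1.2)) = 0
          have hs : (perSite (fineP (L ^ k) m) s.1.1, s.1.2) ≠ b := by
            intro hsb
            have h1 := blockCoord_of_mem_boxBonds L k m c.1 c.2 s.2
            have h2 : blockCoord (L ^ k) m (perSite (fineP (L ^ k) m) s.1.1) = yb := by
              rw [hyb, ← hsb]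
            rw [h2] at h1
            exact hcb (by rcases h1 with h | h <;> [exact Or.inl h.symm; exact Or.inr h.symm])
          rw [Pi.single_eq_of_ne hs, map_zero, smul_zero]
        rw [hzero, map_zero, zero_mul, map_zero, norm_zero]
    -- (b3) the functional's norm, the dualising map, the value
    have hℓ : ‖ℓ b A‖ ≤ 2 * d * (Mτ * Tc * Kmax) := by
      refine ContinuousLinearMap.opNorm_le_bound _ (by positivity) fun X => ?_
      rw [hℓX]
      calc ‖∑ c : Bond d m, τ ((Bc c) (χ c A) (χ c (Pi.single b (φ.symm X))) * K c)‖
          ≤ ∑ c : Bond d m, ‖τ ((Bc c) (χ c A) (χ c (Pi.single b (φ.symm X))) * K c)‖ := norm_sum_le _ _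
        _ ≤ ∑ c : Bond d m, (if c.1 = yb ∨ shift c.2 c.1 = yb then Mτ * Tc * Kmax * ‖X‖ else 0) :=
            Finset.sum_le_sum fun c _ => hterm c X
        _ ≤ 2 * d * (Mτ * Tc * Kmax * ‖X‖) := sum_indicator_two_blocks_le yb (by positivity)
        _ = 2 * d * (Mτ * Tc * Kmax) * ‖X‖ := by ring
    rw [hval, norm_smul, norm_inv]
    calc ‖c₀‖⁻¹ * ‖φ.symm (rieszτ φ (ℓ b A))‖
        ≤ ‖c₀‖⁻¹ * (Mφ' * (Mφ * Mφ * (2 * d * (Mτ * Tc * Kmax)))) := by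
          refine mul_le_mul_of_nonneg_left ((hφ' _).trans (mul_le_mul_of_nonneg_left ((hriesz _).trans ?_) hMφ')) (by positivity)
          exact mul_le_mul_of_nonneg_left hℓ (by positivity)
      _ = _ := by rw [hTc]; ring

end Assembly

end Literature.MathematicalPhysics.QuantumFieldTheory.Balaban1983to89.Beta.RemainderDelta2TorusLocalSup

end
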